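import Summits.QuantumFields.YangMills.Theorems.BalabanLadderIRPinnedExitCofinal
import Summits.QuantumFields.YangMills.Theorems.BalabanLadderIRRankPurityCofinal
import Summits.QuantumFields.YangMills.Theorems.BalabanLadderIRColdPurityDobrushinCorner
import Summits.QuantumFields.YangMills.Theses.BalabanLadder
import HarnessLib

/-!
# LINE 3 «overlap-ruler» — the Fredenhagen–Marcu GLUON-SCREENING (vacuum-overlap) ruler for the crux `IRcof`

Unit `ym-ir-idea-21` (IDEATOR lens «barrier» = LENSES-v3 barrier-inversion), generation g3, seat
`planner-ym-ir-idea-21-g3-0`; rev 2 (§5b only: first lemma F1 → F1′, see there) by g5, seat `planner-ym-ir-idea-21-g5-0`, 2026-08-28 —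
the lens is LAPSED (two critic-concurred nulls; director №39 ∕ R470-ym), this revision is the owed typing repair of record, not a new line.  Crux `Summit.QuantumFields.YangMills.Theses.BalabanLadder.IRcof`
(stmt-QuantumFields-26930); slot of record rev 2 `Cruxes/IRcof/Lines/pinned_cofinal_bill.lean` (ce8a790cd962), tokens
PXcof(1∕24) = `PinnedCofinalBill.PinnedExitsCofinalAt (1/24)` and N_cof = `RankPurity.IRnscCof`.  By-token assembly (D-0146):
this workfile does NOT import the slot file; it re-types PXcof VERBATIM (§0) and reaches the route decl BY NAME through the landed
kernels `PinnedExitCofinal.ircofSC_of_pinnedExitsCofinal_le` + `RankPurity.IRcof_of_split` (§6), exactly as LINE 1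
(`Lines/deconfinement_ruler.lean`) does.

HONEST LABEL.  The Clay Yang–Mills mass-gap problem is NOT proved.  `IRcof` / `IR` stand 0∕1.  Nothing here is continuum ∕ OS ∕ Clay
content; R2c stays IDEA-BOUND; every physical number below is GUIDANCE.  No MC number is used; E2-Q3 (PREREG f96421dbf5158cb3,
jobs j313871 ∕ j313873 ∕ j313621) has NO TABLE at filing and nothing here depends on it; the ruler below is not among E2-Q3's
instruments.  BOTH registered stubs of this line are WALLS with no located engine beyond strong coupling (PRICE declared, §2).

## The barrier inverted, and the lever

Catalogued barrier `Literature.Barriers.QuantumFields.ElitzurTheorem` (PROVED, `ElitzurTheorem_holds`): local gauge symmetry cannot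
break; every local gauge-variant order parameter vanishes.  Its `evasions_known:` line names, besides Wilson ∕ Polyakov loops (LINE 1's
centre ruler) and gauge-fixed propagators (g2 memo C10, dead), «the Fredenhagen–Marcu vacuum-overlap parameter» [FredenhagenMarcu1983].
THE STATEMENT JUST OUTSIDE THE CLASS, typed on the slot's own finite boxes: the GLUON version of the Fredenhagen–Marcu operator
(Bietenholz–Wiese 2025 §14.11, pp. 382–383: «a ratio of two expectation values … numerator = parallel transporters along a staple-shaped path
connecting a source and a sink of color flux … denominator = the square root of a Wegner–Wilson loop of size R × 2T … In a Coulomb phase,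
states of free, unconfined charges exist … the vacuum overlap order parameter then vanishes.  In a confined phase … the dynamical charges are
screened and ρ(R,T) approaches a non-zero constant»), read at the box scale as a SCALING QUOTIENT:

* `N_L(R,T)` = the Wilson mean of the CHARGED trace of the «eared staple» — plaquette ear `P_x = U_{x,23}`, staple `C` of extent `R × T` in
  the plane `(0,1)` traversed there and back, mirror ear `P_y⁻¹`, `y = x + R e₀` — i.e. `Re tr r(P_y⁻¹ C⁻¹ P_x C)` MINUS its Haar-twirled
  singlet part `∫ Re tr r(P_y⁻¹ C⁻¹ g⁻¹ P_x g C) dg` (exact singlet removal for every faithful `r`; vanishes on flat configurations —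
  PROVED `earedStapleObs_flat`);
* `D_L(R,S)` = the Wilson mean of the charged rectangle `|tr r(U_∂(R × S))|² − m_r`, `m_r = ∫ |tr r(g)|² dHaar`;
* the Fredenhagen–Marcu ratio `FM(R,T) = N_L(R,T) ∕ √D_L(R,2T)` and, with `u = ⌊L∕16⌋`, the OVERLAP SCALING QUOTIENT
  `Q_L = FM(4u,2u) ∕ FM(2u,u)`;  `ScreenedAt r β L q : Q_L ≥ q` (division-free, with positivity guards).

WHY A DOUBLE RATIO (the point crit-3 should check first): a cofinal crux reads boxes at `β → ∞`, so a ruler must survive the continuum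
limit at fixed physical box.  The FM square root cancels the perimeter ∕ corner self-energies of the doubled staple against the charged
rectangle (FM's design); the big∕small quotient cancels what the square root does not — the local, geometry-independent renormalisation of
the plaquette ears (`∝ a⁴ Z_E(g)²`) and of the ear–staple junctions (multiplicative renormalisability of loop functionals, Dotsenko–Vergeles ∕
Brandt–Neri–Sato, folklore).  What is left is a unit-free, twist-free, CENTRE-BLIND number with two universal values (GUIDANCE heuristics):
`Q_L → q_fem(G) < 1` in an asymptotically free box (Gaussian part `2⁻⁴ = 1∕16` from the canonical dimension `2` of each chromomagnetic
ear, `FM ≍ g²(ℓ) R⁻⁴`, dressed by an `O(1)` finite-torus ∕ toron factor), and `Q_L → 1` in a gluon-screened (string-broken) box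
(`FM(R,T) → ρ_∞ Z_E² > 0` independent of `R, T`).  The locator passes in the right
direction: in a phase with free charges the FM amplitude keeps its Coulombic scaling (`U(1)₄`: the charged numerator is identically `0`,
`ScreenedAt` is false, S2 vacuous, S1 false — consistent with impurity there; barrier `AbelianDeconfinementD4_holds`).  CENTRE-BLIND: for
`G₂, F₄, E₈` every charge is screened by gluons and `Q_L → 1` all the same — so, unlike LINE 1, NO centre case-split and NO verbatim (CF)
restate: three stubs, all `G` uniformly.  NO THRESHOLD IS TYPED (typing checklist 4c(iv)): S1 asserts that EVERY level `q < 1` is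
reached (FM scale-freeness), S2 that SOME level `q < 1` certifies purity; the femto value `q_fem(G)` never enters the statements.

## The cut (ranked; sorries ONLY in §3)

* S1 `PinnedScreenedCofinal` (rank 2, wall-1, «reaching the string-breaking scale inside the floor window, on arbitrarily fine
  lattices»): for simply-connected simple `G`, every faithful `r`, every floor-respecting unit map `a → 0`:
  `∀ q < 1 ∃ T ∀ L₁ ∀ β₁ ∃ β ≥ β₁ ∃ L ≥ max 16 L₁`, `a(β)·L ≤ T ∧ ScreenedAt r β L q`.  Why it might fail: `LowerBounds` pins units too
  coarse for a screened box (`a(β)·ℓ_s(β)∕a_phys(β) → ∞`), or the heuristic UV-cancellation in `Q_L` fails (no `β`-uniform super-femto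
  level in screened boxes).  Without the floor it is FALSE for the same reason (CU) is (slow units put every pinned box in the femto
  regime; p624174's mechanism).  Sources: [FredenhagenMarcu1983]; Bietenholz–Wiese §14.11; census C4 (no printed arrow at weak coupling).
* S2 `ScreenedToPure θ` (rank 3, wall-2 = the F ⇒ V arrow, census C4 «no printed implication at either arrow»): for simply-connected simple
  `G` and every `r`: `∃ q < 1 ∃ κ ≥ 1 ∃ β₀ ∃ L₁ ∀ β ≥ β₀ ∀ L ≥ max 16 L₁`, `ScreenedAt r β L q → coldDefect r β (κL) ≤ θ`.  One-scale
  folklore: any `q ∈ (q_fem(G), 1)` forces `g²(ℓ)` bounded below, a PHYSICAL lower bound on the box and an upper bound on its temperature,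
  whence `κ(q)·ℓ` is cold and vacuum-dominated.  Why it might fail: `q_fem(G) ≥ 1` for the slot's geometry (tree-level lattice PT with
  torons — the cheapest falsifier), or a two-scale Yang–Mills world (`sup_β` cold-pure scale ∕ screening scale `= ∞`); bulk transitions of exotic faithful `r` and `O(u⁻²)` artefacts of small staples are absorbed by `∃ β₀, L₁`.  RUNG (PROVED, §5):
  inside the Dobrushin door `216·N·β ≤ 1` one group-free `κ` works (hypothesis unused).
* N_cof `IRnscCof` (the slot's second token, BY NAME; rows 38–40 ∕ 47 own it).

Composition (PROVED, §4, §6): `S1 → S2(θ) → PXcof(θ)` (`pxcof_of_overlap`: S2 at S1's level `q` gives `κ, β₀, L₁`; S1 at fineness `L₁` beyond `max β₁ β₀` gives the box; S2 reads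
`coldDefect (κL) ≤ θ`, pinned by `κT`) and `IRcof_of_stubs : Theses.BalabanLadder.IRcof`.

FIRST LEMMA (typed `Prop`, §5b, no sorry, located-B) — rev 2: **F1′ `ScreenedAtStrongCouplingSimple`** — the Fredenhagen–Marcu ∕
Bietenholz–Wiese strong-coupling tube picture as a theorem target, for compact SIMPLE `G` (the side condition S1 ∕ S2 carry): for `0 < β`,
`216·N·β ≤ 1` and every level `q < 1`, all large boxes have `Q_L ≥ q` (polymer ∕ character expansion of numerator and charged square; FM83 prove
the `ℤ₂`-Higgs analogue by convergent expansions).  It is S1's strong-coupling corner and the calibration of the ruler; it is NOT width toward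
PXcof (sieve S3: inoperative as `β → ∞`).  The rev-1 first lemma F1 `ScreenedAtStrongCoupling` (same text WITHOUT the simplicity binder) is
FALSE AS TYPED — pool prover `ym-ir-line-pool-p3` g16, `Lines/overlap_ruler_abelian_negative.lean` (crux write c942a8e28728; evidence #55 on
26930; critic TYPEREAD CLEAN + UPHELD, crit-3 g4 2026-08-28T22:35:56Z): for ABELIAN `G` the Haar twirl is the identity, `earedStapleObs ≡ 0`,
`N_L ≡ 0`, the guard `0 < N_L(2u,u)` fails at every `(β, L, q)`; witness `G = U(1)`, `N = 1`, `β = 1∕216`, `q = 0`; class MISSTATED.  F1 is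
KEPT in §5b verbatim as the settled negative edge and superseded by F1′ (`screenedAtStrongCouplingSimple_of : F1 → F1′`; the witness misses
F1′: `AbelianNegative.not_isCompactSimpleLieGroup_circle`).  Nothing else changes: S1 ∕ S2 ∕ `pxcof_of_overlap` ∕ the rung ∕ `IRcof_of_stubs`
never mention F1 (census v6.93 row 49: class PWP ∕ B− unchanged, located lemma RE-NAMED F1′).

Disproof ∕ negatives honoured: S1 carries `LowerBounds` (p630186 `IR_false_without_LowerBounds`, p624174 `not_pinnedExitsCofinalFree`: the
line uses H = the floor at the pin, in S1); no stub is an instance of `not_uniformExit24` (S1 is `∀ β₁ ∃ β ∃ L`, not `∃ L ∀ β`); no refuted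
statement of `ledger negatives --problem QuantumFields` (PlaquetteCovarianceNonneg, DiagonalMirrorRP, coupling-first, binder, floor-free bills)
is re-asked.  Costume check (crit-3 №13): neither S1 nor S2 is Iff to E ∕ PX ∕ PXcof — S1 is a Wilson-loop scaling-quotient statement skew to purity
(purity does not control eared-staple amplitudes; a super-femto `Q_L` does not control `Tr 𝒯^{2t}∕(Tr 𝒯^t)²` at the same `L`), S2 is an implication with a
hypothesis strictly different from (G)'s `MarginConfinedAt` (no twist, no centre) — the line shares NO decl with LINE 1 ∕ LINE 2.

References: K. Fredenhagen, M. Marcu, Commun. Math. Phys. 92 (1983) 81 [FredenhagenMarcu1983]; W. Bietenholz, U.-J. Wiese, *Uncovering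
Quantum Field Theory and the Standard Model* (CUP 2025) §14.11 [corpus:bietenholz2025 pp. 382–383]; J. Greensite, *An Introduction to the
Confinement Problem* (2011) §3.3, §9.3 [corpus:greensite2011 pp. 29, 114–115]; tree `Literature.Barriers.QuantumFields.ElitzurTheorem`
(evasions_known), `…AbelianDeconfinementD4`, `…NonabelianCoulombPhaseD5`; census REDUCTION-CENSUS v6.74 §C row C4, §L rows 42 ∕ 44, lit-4 N3.
-/

noncomputable section

open Filter Topology MeasureTheory
open Literature.MathematicalPhysics.QuantumFieldTheory Literature.MathematicalPhysics.QuantumLattice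
open Summit.QuantumFields.YangMills.Cruxes.OSLegsFromFemtoAndGap.DlrCollarTransfer (LowerBounds)
open Summit.QuantumFields.YangMills.Cruxes.IR.ColdPurityBridge (coldDefect)
open Summit.QuantumFields.YangMills.Cruxes.IR.RankPurity (IRnscCof IRcof_of_split)
open Summit.QuantumFields.YangMills.Cruxes.IR.PinnedExitCofinal (ircofSC_of_pinnedExitsCofinal_le)
open Summit.QuantumFields.YangMills.Cruxes.IR.ColdPurityDobrushin (coldExitAt_corner_of_dobrushinTV)

namespace Summit.QuantumFields.YangMills.Cruxes.IRcof.OverlapRuler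

/-! ## §0 The slot token, verbatim (`PinnedCofinalBill.PinnedExitsCofinalAt`, ce8a790cd962) -/

/-- **PXcof(θ)** — verbatim copy of the slot's `PinnedCofinalBill.PinnedExitsCofinalAt θ` (the `Lines/` workfile is not imported; the body is
the hypothesis of the landed kernel `PinnedExitCofinal.ircofSC_of_pinnedExitsCofinal_le`). -/
def PinnedExitsCofinalAt (θ : ℝ) : Prop :=
  ∀ (G : Type) [Group G] [TopologicalSpace G] [IsTopologicalGroup G] [CompactSpace G],
    IsCompactSimpleLieGroup G → SimplyConnectedSpace G →
    letI : MeasurableSpace G := borel G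
    haveI : BorelSpace G := ⟨rfl⟩
    ∀ (r : LatticeRep G) (a : ℝ → ℝ), (∀ β, 0 < a β) → Tendsto a atTop (𝓝 0) → LowerBounds G r a →
      ∃ T : ℝ, ∀ β₁ : ℝ, ∃ β : ℝ, β₁ ≤ β ∧ ∃ L : ℕ, 8 ≤ L ∧ a β * (L : ℝ) ≤ T ∧ coldDefect r.ρ β L ≤ θ

/-! ## §1 The gluon-screening (vacuum-overlap) ruler on the slot's boxes `L × L × L × ⌊L∕4⌋` -/

section Ruler

variable {G : Type} [Group G]

/-- `k`-fold shift `x + k e_μ` on the `Fin`-indexed torus (periodic). [folklore] -/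
def shiftIter {n₀ n₁ n₂ n₃ : ℕ} (x : FinTorusSite n₀ n₁ n₂ n₃) (μ : Fin 4) : ℕ → FinTorusSite n₀ n₁ n₂ n₃
  | 0 => x
  | k + 1 => (shiftIter x μ k).shift μ

/-- Straight Wilson line of `k` links from `x` in direction `μ`: `U(x,μ) U(x+e_μ,μ) ⋯ U(x+(k−1)e_μ,μ)`. [folklore] -/
def lineHol {n₀ n₁ n₂ n₃ : ℕ} (U : FinTorusSite n₀ n₁ n₂ n₃ × Fin 4 → G) (x : FinTorusSite n₀ n₁ n₂ n₃) (μ : Fin 4) : ℕ → G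
  | 0 => 1
  | k + 1 => lineHol U x μ k * U (shiftIter x μ k, μ)

/-- The STAPLE `x → x + T e₁ → x + T e₁ + R e₀ → x + R e₀` in the plane `(0,1)` (parallel transporter from `x` to `y = x + R e₀`).
[cite: FredenhagenMarcu1983] -/
def stapleHol {n₀ n₁ n₂ n₃ : ℕ} (U : FinTorusSite n₀ n₁ n₂ n₃ × Fin 4 → G) (x : FinTorusSite n₀ n₁ n₂ n₃) (R T : ℕ) : G :=
  lineHol U x 1 T * lineHol U (shiftIter x 1 T) 0 R * (lineHol U (shiftIter x 0 R) 1 T)⁻¹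

/-- The boundary of the rectangle `R × S` in the plane `(0,1)` based at `x` (a Wegner–Wilson loop holonomy). [cite: Wilson1974] -/
def rectHol {n₀ n₁ n₂ n₃ : ℕ} (U : FinTorusSite n₀ n₁ n₂ n₃ × Fin 4 → G) (x : FinTorusSite n₀ n₁ n₂ n₃) (R S : ℕ) : G :=
  lineHol U x 0 R * lineHol U (shiftIter x 0 R) 1 S * (lineHol U (shiftIter x 1 S) 0 R)⁻¹ * (lineHol U x 1 S)⁻¹

variable {N : ℕ} (ρ : G →* Matrix (Fin N) (Fin N) ℂ)

/-- **The eared-staple trace** `Re tr ρ(P_y⁻¹ · C⁻¹ · P_x · C)`: ears `P_x = U_{x,23}` and the MIRROR ear `P_y⁻¹`, `y = x + R e₀`, joined by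
the staple `C` of extent `R × T` in the plane `(0,1)` traversed there AND back — one gauge-invariant closed curve in the representation `ρ`
(the gluon Fredenhagen–Marcu numerator before removing the colour-singlet flux; the mirror orientation of the second ear is the
reflection-positive arrangement for the site reflection in direction `0` through the midpoint of the `R`-leg). [cite: FredenhagenMarcu1983] -/
def earedStapleTr {n₀ n₁ n₂ n₃ : ℕ} (R T : ℕ) (U : FinTorusSite n₀ n₁ n₂ n₃ × Fin 4 → G) (x : FinTorusSite n₀ n₁ n₂ n₃) : ℝ :=
  (ρ ((finTorusPlaquette U (shiftIter x 0 R) 2 3)⁻¹ * (stapleHol U x R T)⁻¹ * finTorusPlaquette U x 2 3 * stapleHol U x R T)).trace.re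

variable [TopologicalSpace G] [IsTopologicalGroup G] [CompactSpace G] [MeasurableSpace G] [BorelSpace G]

/-- **The colour-singlet part of the eared-staple trace, by Haar twirl:** `∫_G Re tr ρ(P_y⁻¹ · C⁻¹ · g⁻¹ · P_x · g · C) dg` — inserting an
independent Haar rotation in the middle of the doubled staple projects `ρ ⊗ ρ̄` onto ALL its singlet channels (`∫ ρ(g)⁻¹ X ρ(g) dg` is the
conditional expectation onto the commutant `ρ(G)'`, of dimension `m_ρ`); exact for every faithful `ρ`, reducible or not (a `1∕N`-Fierz
subtraction would leave disconnected singlet pieces of size `O(g⁴)` for reducible `ρ` and spoil the femto reading). [folklore] -/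
def earedStapleSinglet {n₀ n₁ n₂ n₃ : ℕ} (R T : ℕ) (U : FinTorusSite n₀ n₁ n₂ n₃ × Fin 4 → G) (x : FinTorusSite n₀ n₁ n₂ n₃) : ℝ :=
  ∫ g, (ρ ((finTorusPlaquette U (shiftIter x 0 R) 2 3)⁻¹ * (stapleHol U x R T)⁻¹ * g⁻¹ * finTorusPlaquette U x 2 3 * g
      * stapleHol U x R T)).trace.re ∂(haarProbability G)

/-- **The CHARGED eared-staple observable** (gluon Fredenhagen–Marcu numerator): trace minus its Haar-twirled singlet part — only colour flux
genuinely transported along the staple survives; vanishes identically for abelian `G`. [cite: FredenhagenMarcu1983] -/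
def earedStapleObs {n₀ n₁ n₂ n₃ : ℕ} (R T : ℕ) (U : FinTorusSite n₀ n₁ n₂ n₃ × Fin 4 → G) (x : FinTorusSite n₀ n₁ n₂ n₃) : ℝ :=
  earedStapleTr ρ R T U x - earedStapleSinglet ρ R T U x

/-- **Calibration: the charged eared-staple observable VANISHES ON FLAT CONFIGURATIONS** (`U ≡ 1`): the Haar twirl removes exactly the
flux-free part (PROVED; the ruler reads transported colour flux only). -/
theorem earedStapleObs_flat {n₀ n₁ n₂ n₃ : ℕ} (R T : ℕ) (x : FinTorusSite n₀ n₁ n₂ n₃) :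
    earedStapleObs ρ R T (fun _ => (1 : G)) x = 0 := by
  have hP : ∀ (y : FinTorusSite n₀ n₁ n₂ n₃) (μ ν : Fin 4), finTorusPlaquette (fun _ => (1 : G)) y μ ν = 1 := by
    intro y μ ν; simp [finTorusPlaquette]
  have hL : ∀ (y : FinTorusSite n₀ n₁ n₂ n₃) (μ : Fin 4) (k : ℕ), lineHol (fun _ => (1 : G)) y μ k = 1 := by
    intro y μ k; induction k <;> simp [lineHol, *]
  have hC : ∀ (y : FinTorusSite n₀ n₁ n₂ n₃) (R T : ℕ), stapleHol (fun _ => (1 : G)) y R T = 1 := by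
    intro y R T; simp [stapleHol, hL]
  haveI : IsProbabilityMeasure (haarProbability G) := inferInstance
  simp [earedStapleObs, earedStapleTr, earedStapleSinglet, hP, hC, Matrix.trace_one]

/-- The singlet content `m_ρ = ∫ |tr ρ(g)|² dHaar(g)` of `ρ ⊗ ρ̄` (Schur orthogonality: `dim ρ(G)'`; `1` for irreducible `ρ`). [folklore] -/
def haarTraceSq : ℝ := ∫ g, ‖(ρ g).trace‖ ^ 2 ∂(haarProbability G)

/-- **The charged rectangle observable** `|tr ρ(U_∂(R × S))|² − m_ρ` (the `ρ ⊗ ρ̄` Wegner–Wilson loop with its singlet part removed —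
the «adjoint loop» of Bietenholz–Wiese (14.65) for a general faithful `ρ`). [cite: FredenhagenMarcu1983] -/
def chargedRectObs {n₀ n₁ n₂ n₃ : ℕ} (R S : ℕ) (U : FinTorusSite n₀ n₁ n₂ n₃ × Fin 4 → G) (x : FinTorusSite n₀ n₁ n₂ n₃) : ℝ :=
  ‖(ρ (rectHol U x R S)).trace‖ ^ 2 - haarTraceSq ρ

/-- Wilson's Boltzmann weight on the `Fin`-indexed torus (VERBATIM the integrand of `wilsonFinTorusPartition`). [cite: Wilson1974] -/
def finTorusWilsonWeight (β : ℝ) {n₀ n₁ n₂ n₃ : ℕ} (U : FinTorusSite n₀ n₁ n₂ n₃ × Fin 4 → G) : ℝ :=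
  Real.exp (-β * ∑ x : FinTorusSite n₀ n₁ n₂ n₃, ∑ q : {q : Fin 4 × Fin 4 // q.1 < q.2},
      ((N : ℝ) - (ρ (finTorusPlaquette U x q.1.1 q.1.2)).trace.re))

/-- The Wilson MEAN of the site-average of a based observable `O U x` on the torus `n₀ × n₁ × n₂ × n₃` (site-averaging avoids choosing a
base point; by translation invariance it is the mean of any single `O · x`).  `Z > 0` is the tree's `wilsonFinTorusPartition_pos`. [folklore] -/
def finTorusSiteMean (β : ℝ) (n₀ n₁ n₂ n₃ : ℕ)
    (O : (FinTorusSite n₀ n₁ n₂ n₃ × Fin 4 → G) → FinTorusSite n₀ n₁ n₂ n₃ → ℝ) : ℝ :=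
  (∫ U, ((∑ x : FinTorusSite n₀ n₁ n₂ n₃, O U x) / (Fintype.card (FinTorusSite n₀ n₁ n₂ n₃) : ℝ))
        * finTorusWilsonWeight ρ β U
      ∂(Measure.pi fun _ : FinTorusSite n₀ n₁ n₂ n₃ × Fin 4 => haarProbability G))
    / wilsonFinTorusPartition ρ β n₀ n₁ n₂ n₃

/-- `N_L(R,T)` — the charged eared-staple MEAN (Fredenhagen–Marcu numerator) on the slot's box `L³ × ⌊L∕4⌋`. -/
def overlapNum (β : ℝ) (L R T : ℕ) : ℝ :=
  finTorusSiteMean ρ β L L L (L / 4) (earedStapleObs ρ R T)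

/-- `D_L(R,S)` — the charged-rectangle MEAN (Fredenhagen–Marcu denominator before the square root) on the slot's box `L³ × ⌊L∕4⌋`. -/
def overlapDen (β : ℝ) (L R S : ℕ) : ℝ :=
  finTorusSiteMean ρ β L L L (L / 4) (chargedRectObs ρ R S)

/-- **`ScreenedAt ρ β L q` — THE RULER READING (the OVERLAP SCALING QUOTIENT of the box is at least `q`).**  With `u = ⌊L∕16⌋`, big staple
`(R,T) = (4u,2u)` over the charged square `4u × 4u`, small staple `(2u,u)` over `2u × 2u`:
`Q_L := [N_L(4u,2u) ∕ √D_L(4u,4u)] ∕ [N_L(2u,u) ∕ √D_L(2u,2u)] ≥ q`, typed division-free with its positivity guards.  A DOUBLE ratio: the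
Fredenhagen–Marcu square root cancels the perimeter ∕ corner self-energies of the doubled staple, the big∕small quotient cancels the local
(coupling-dependent but geometry-independent) renormalisation of the plaquette ears and of the ear–staple junctions — so `Q_L` is a unit-free,
twist-free, CENTRE-BLIND reading with (heuristically) a continuum limit at fixed physical box, separating `q_fem(G) < 1` (Coulombic at its
own scale; Gaussian part `2⁻⁴`) from `1` (gluon-screened at its own scale: FM scale-free). [cite: FredenhagenMarcu1983] -/
def ScreenedAt (β : ℝ) (L : ℕ) (q : ℝ) : Prop :=
  0 < overlapNum ρ β L (2 * (L / 16)) (L / 16) ∧ 0 < overlapDen ρ β L (4 * (L / 16)) (4 * (L / 16)) ∧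
    0 < overlapDen ρ β L (2 * (L / 16)) (2 * (L / 16)) ∧
    q * (overlapNum ρ β L (2 * (L / 16)) (L / 16) * Real.sqrt (overlapDen ρ β L (4 * (L / 16)) (4 * (L / 16)))) ≤
      overlapNum ρ β L (4 * (L / 16)) (2 * (L / 16)) * Real.sqrt (overlapDen ρ β L (2 * (L / 16)) (2 * (L / 16)))

end Ruler

/-! ## §2 The two statements of the cut (+ the slot's N_cof by name) -/

/-- **S1 `PinnedScreenedCofinal` — FREDENHAGEN–MARCU SCALE-FREENESS IS REACHED UNDER THE PIN, ON ARBITRARILY FINE LATTICES, AT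
COFINALLY MANY COUPLINGS (wall-1).**  For simply-connected compact simple `G`, every faithful `r`, every positive unit map `a → 0` with
`LowerBounds G r a`, and every level `q < 1`: there is a pin `T` such that for every fineness `L₁` and every `β₁` some `β ≥ β₁` and some
`L ≥ max 16 L₁` have `a(β)·L ≤ T ∧ ScreenedAt r.ρ β L q` (`Q_L ≥ q`).  Heuristic: in a gluon-screened box the FM amplitude is scale-free,
`Q_L → 1` as the box grows in string-breaking units, and a floor-respecting unit is at most a fixed multiple of the physical one, so
`T = T(q)` floor units suffice.  Why it might fail: the floor's units are too coarse for any screened box to be pinned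
(`a(β)·ℓ_s(β)∕a_phys(β) → ∞` along a cofinal sequence), or the heuristic UV-cancellation in `Q_L` fails (no `β`-uniform approach to `1`).
Without the floor it is FALSE exactly as (CU) is (slow units put every pinned box in the femto regime, where `Q_L` stays bounded away from
`1`; p624174's mechanism).  NO CONSTANT is typed: the level is universally quantified.  PRICE: no engine beyond strong coupling (first
lemma `ScreenedAtStrongCoupling`, §5b, which is S1's shape minus the pin inside the Dobrushin door). -/
def PinnedScreenedCofinal : Prop :=
  ∀ (G : Type) [Group G] [TopologicalSpace G] [IsTopologicalGroup G] [CompactSpace G],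
    IsCompactSimpleLieGroup G → SimplyConnectedSpace G →
    letI : MeasurableSpace G := borel G
    haveI : BorelSpace G := ⟨rfl⟩
    ∀ (r : LatticeRep G) (a : ℝ → ℝ), (∀ β, 0 < a β) → Tendsto a atTop (𝓝 0) → LowerBounds G r a →
      ∀ q : ℝ, q < 1 → ∃ T : ℝ, ∀ L₁ : ℕ, ∀ β₁ : ℝ, ∃ β : ℝ, β₁ ≤ β ∧
        ∃ L : ℕ, max 16 L₁ ≤ L ∧ a β * (L : ℝ) ≤ T ∧ ScreenedAt r.ρ β L q

/-- **S2 `ScreenedToPure θ` — SOME SUB-UNITY LEVEL OF FM SCALE-FREENESS AT SCALE `L` CERTIFIES `θ`-PURITY AT SCALE `κL`, UNIFORMLY IN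
THE COUPLING (floor-free, unit-free, twist-free; the F ⇒ V arrow, wall-2).**  For simply-connected compact simple `G` (ANY centre) and every
`r`: there are a level `q < 1`, a factor `κ ≥ 1`, a `β₀` and a fineness `L₁` such that for all `β ≥ β₀` and `L ≥ max 16 L₁`,
`ScreenedAt r.ρ β L q → coldDefect r.ρ β (κL) ≤ θ`.  One-scale folklore: the femto (asymptotically free) value of `Q_L` is a tree-level
number `q_fem(G) < 1` (Gaussian part `≈ 2⁻⁴` from the dimension `2` of each chromomagnetic ear, dressed by an `O(1)` finite-torus ∕ toron
factor), so any `q ∈ (q_fem, 1)` forces `g²(ℓ)` bounded below, i.e. a PHYSICAL lower bound on the box and an upper bound on its temperature,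
whence `κ(q)·ℓ` is cold and vacuum-dominated.  Why it might fail: `q_fem(G) ≥ 1` for the slot's geometry (computable: tree-level lattice
perturbation theory of `Q_L` with torons — the line's cheapest falsifier), or a two-scale Yang–Mills world (`sup_β` cold-pure scale ∕
screening scale `= ∞`); census C4: no printed implication at either arrow.  `∃ β₀, L₁` absorb bulk transitions of exotic `r` and lattice
artefacts of small staples.  NO CONSTANT is typed: the level is existentially quantified.  RUNG (PROVED, §5): inside the Dobrushin door one
group-free `κ` works at every level (hypothesis unused). -/
def ScreenedToPure (θ : ℝ) : Prop :=
  ∀ (G : Type) [Group G] [TopologicalSpace G] [IsTopologicalGroup G] [CompactSpace G],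
    IsCompactSimpleLieGroup G → SimplyConnectedSpace G →
    letI : MeasurableSpace G := borel G
    haveI : BorelSpace G := ⟨rfl⟩
    ∀ r : LatticeRep G, ∃ q : ℝ, q < 1 ∧
      ∃ κ : ℕ, ∃ β₀ : ℝ, ∃ L₁ : ℕ, 1 ≤ κ ∧ ∀ β : ℝ, β₀ ≤ β → ∀ L : ℕ, max 16 L₁ ≤ L →
        ScreenedAt r.ρ β L q → coldDefect r.ρ β (κ * L) ≤ θ

/-! ## §3 Stubs (sorries ONLY here) -/

/-- **stub S1** — every level `q < 1` of FM scale-freeness is reached by pinned boxes on arbitrarily fine lattices, cofinally, under the floor. -/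
theorem stub_pinnedScreenedCofinal : PinnedScreenedCofinal := by
  sorry

/-- **stub S2** — some level `q < 1` at `L` ⇒ `1∕24`-pure at `κL`, `κ` uniform in `β` (the located residual: one-scale YM). -/
theorem stub_screenedToPure : ScreenedToPure (1 / 24) := by
  sorry

/-- **stub N_cof** — the slot's second token BY NAME (`RankPurity.IRnscCof`). -/
theorem stub_irnscCof : IRnscCof := by
  sorry

/-! ## §4 The composition onto the token PXcof (PROVED, stub-free) -/

/-- **`S1 ∧ S2(θ) ⇒ PXcof(θ)` (PROVED).**  S2 supplies the level `q < 1` with `κ, β₀, L₁`; S1 at that level gives the pin `T` and, at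
fineness `L₁` beyond `max β₁ β₀`, a pinned box with `Q_L ≥ q`; S2 reads `coldDefect (κL) ≤ θ` — pinned by `κT`.  No centre case-split
(contrast LINE 1's `pxcof_of_ruler`), no constant. -/
theorem pxcof_of_overlap {θ : ℝ} (h1 : PinnedScreenedCofinal) (h2 : ScreenedToPure θ) : PinnedExitsCofinalAt θ := by
  intro G _ _ _ _ hGs hsc
  letI : MeasurableSpace G := borel G
  haveI : BorelSpace G := ⟨rfl⟩
  intro r a ha ha0 hlb
  obtain ⟨q, hq, κ, β₀, L₁, hκ, hup⟩ := h2 G hGs hsc r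
  obtain ⟨T, hcof⟩ := h1 G hGs hsc r a ha ha0 hlb q hq
  refine ⟨(κ : ℝ) * T, fun β₁ => ?_⟩
  obtain ⟨β, hβ, L, hL, hpin, hscr⟩ := hcof L₁ (max β₁ β₀)
  refine ⟨β, (le_max_left _ _).trans hβ, κ * L, ?_, ?_, hup β ((le_max_right _ _).trans hβ) L hL hscr⟩
  · calc 8 ≤ 16 := by norm_num
      _ ≤ max 16 L₁ := le_max_left _ _
      _ ≤ L := hL
      _ = 1 * L := (one_mul L).symm
      _ ≤ κ * L := Nat.mul_le_mul_right L hκ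
  · have hk : (0 : ℝ) ≤ (κ : ℝ) := Nat.cast_nonneg κ
    calc a β * ((κ * L : ℕ) : ℝ) = (κ : ℝ) * (a β * (L : ℝ)) := by push_cast; ring
      _ ≤ (κ : ℝ) * T := mul_le_mul_of_nonneg_left hpin hk

/-! ## §5 S2's rung at strong coupling (PROVED) and the line's first lemma (typed) -/

/-- **S2 at strong coupling, ONE group-free `κ`:** for every `θ > 0` there is `κ ≥ 1` such that for every compact `G`, every `r`, every
`0 ≤ β ≤ 1∕(216N)`, every `L ≥ 16` and every level `q`, `ScreenedAt r.ρ β L q → coldDefect r.ρ β (κL) ≤ θ` — from the landed cold-purity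
corner `ColdPurityDobrushin.coldExitAt_corner_of_dobrushinTV` (the hypothesis is not used: inside the door every long box is pure). -/
theorem screenedToPure_rung_dobrushin {θ : ℝ} (hθ : 0 < θ) :
    ∃ κ : ℕ, 1 ≤ κ ∧ ∀ (G : Type) [Group G] [TopologicalSpace G] [IsTopologicalGroup G] [CompactSpace G]
      [MeasurableSpace G] [BorelSpace G] (r : LatticeRep G) (β : ℝ), 0 ≤ β → 216 * (r.N : ℝ) * β ≤ 1 →
      ∀ L : ℕ, 16 ≤ L → ∀ q : ℝ, ScreenedAt r.ρ β L q → coldDefect r.ρ β (κ * L) ≤ θ := by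
  obtain ⟨L₀, hL₀⟩ := coldExitAt_corner_of_dobrushinTV hθ
  refine ⟨max L₀ 1, le_max_right _ _, fun G _ _ _ _ _ _ r β h0 hβ L hL q _ => ?_⟩
  refine hL₀ G r β h0 hβ (max L₀ 1 * L) ?_
  calc L₀ ≤ max L₀ 1 := le_max_left _ _
    _ = max L₀ 1 * 1 := (mul_one _).symm
    _ ≤ max L₀ 1 * L := Nat.mul_le_mul_left _ (by omega)

/-- S2's strong-coupling corner in S2's own quantifier shape (bookkeeping over the rung): for `θ > 0`, every compact `G`, every `r` and
every `β` in the Dobrushin door, the body of `ScreenedToPure θ` holds at that `β` with level `q := 0`, `β₀ := β`, `L₁ := 0`. -/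
theorem screenedToPure_at_dobrushin {θ : ℝ} (hθ : 0 < θ) (G : Type) [Group G] [TopologicalSpace G] [IsTopologicalGroup G]
    [CompactSpace G] [MeasurableSpace G] [BorelSpace G] (r : LatticeRep G) (β : ℝ) (h0 : 0 ≤ β) (hβ : 216 * (r.N : ℝ) * β ≤ 1) :
    ∃ q : ℝ, q < 1 ∧ ∃ κ : ℕ, 1 ≤ κ ∧ ∀ L : ℕ, max 16 0 ≤ L → ScreenedAt r.ρ β L q → coldDefect r.ρ β (κ * L) ≤ θ := by
  obtain ⟨κ, hκ, h⟩ := screenedToPure_rung_dobrushin hθ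
  exact ⟨0, by norm_num, κ, hκ, fun L hL hs => h G r β h0 hβ L (by simpa using hL) 0 hs⟩

/-! ## §5b The line's FIRST LEMMA toward S1, typed (a `Prop`, no sorry; located-B): screening at strong coupling

rev 2 (unit `ym-ir-idea-21` g5, 2026-08-28): the rev-1 first lemma F1 `ScreenedAtStrongCoupling` is FALSE AS TYPED — pool prover
`ym-ir-line-pool-p3` g16, `Lines/overlap_ruler_abelian_negative.lean` (crux write c942a8e28728; `AbelianNegative.not_screenedAtStrongCoupling`,
axioms standard; critic TYPEREAD CLEAN + UPHELD, crit-3 g4 22:35:56Z): F1 quantifies over EVERY compact `G` (no `IsCompactSimpleLieGroup G`,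
unlike S1 ∕ S2), and for abelian `G` the Haar twirl `g⁻¹ P_x g = P_x` is the identity, so `earedStapleSinglet = earedStapleTr`,
`earedStapleObs ≡ 0`, `N_L ≡ 0` and the positivity guard `0 < N_L(2u,u)` of `ScreenedAt` fails at every `(β, L, q)`; witness `G = U(1)`,
`r = LatticeRep.circle` (`N = 1`), `β = 1∕216`, `q = 0`.  Class MISSTATED (missing side condition), not substantive.  Following the repair
convention (a refuted statement is never re-worded in place), F1 is KEPT below verbatim as the settled negative edge and SUPERSEDED by
**F1′ `ScreenedAtStrongCouplingSimple`** := F1 with `IsCompactSimpleLieGroup G →` inserted after the instance binders — character-identical to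
the repaired reading pool-p3 recorded (`AbelianNegative.ScreenedAtStrongCouplingSimple`), which the abelian witness misses
(`AbelianNegative.not_isCompactSimpleLieGroup_circle`).  Why the one binder suffices against this junk class: `LatticeRep` is FAITHFUL by
definition (`LatticeRep.injective`), so for simple (hence non-abelian) `G` the image `r.ρ(G)` is non-commutative and the twirl is a genuine
conditional expectation, not the identity; the trivial group and every compact abelian group are excluded by `IsSimpleCompactGroup`'s
non-commuting pair.  `SimplyConnectedSpace G` (carried by S1 ∕ S2 because the slot token is the simply-connected leaf) is immaterial for a
strong-coupling calibration lemma and is left out (crit-3 g4).  F1′ is row 49's located first lemma of record (census v6.93: «located lemma :=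
F1′ … OPEN, size L, un-keyed»); it is NOT width toward PXcof. -/

/-- **F1 (rev 1) `ScreenedAtStrongCoupling` — REFUTED AS TYPED (abelian `G`: `AbelianNegative.not_screenedAtStrongCoupling`, pool-p3 g16
c942a8e28728); kept verbatim as the negative edge, superseded by F1′ `ScreenedAtStrongCouplingSimple` below.**  Original gloss: the
Fredenhagen–Marcu ∕ Bietenholz–Wiese strong-coupling TUBE picture as a theorem target, on the slot's boxes: for every compact `G` (← the slip:
no simplicity binder), every faithful `r`, every `0 < β` with `216·N·β ≤ 1` and every level `q < 1` there is a fineness `L₁` with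
`ScreenedAt r.ρ β L q` for all `L ≥ L₁`. [cite: FredenhagenMarcu1983] -/
def ScreenedAtStrongCoupling : Prop :=
  ∀ (G : Type) [Group G] [TopologicalSpace G] [IsTopologicalGroup G] [CompactSpace G] [MeasurableSpace G] [BorelSpace G]
    (r : LatticeRep G) (β : ℝ), 0 < β → 216 * (r.N : ℝ) * β ≤ 1 →
    ∀ q : ℝ, q < 1 → ∃ L₁ : ℕ, ∀ L : ℕ, L₁ ≤ L → ScreenedAt r.ρ β L q

/-- **F1′ `ScreenedAtStrongCouplingSimple` (rev 2; row 49's located FIRST LEMMA of record)** — the Fredenhagen–Marcu ∕ Bietenholz–Wiese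
strong-coupling TUBE picture as a theorem target, on the slot's boxes `L³ × ⌊L∕4⌋`: for every compact SIMPLE Lie group `G`, every (faithful)
`r : LatticeRep G`, every `0 < β` with `216·N·β ≤ 1` and every level `q < 1` there is a fineness `L₁` with `ScreenedAt r.ρ β L q` (`Q_L ≥ q`)
for all `L ≥ L₁` — numerator and charged square are dominated by the minimal plaquette tubes along the doubled staple resp. the square's
perimeter, by convergent polymer ∕ character expansion inside the Dobrushin door; the tube weights per unit length coincide, so each
Fredenhagen–Marcu ratio is `R,T`-independent up to exponentially small corrections and the quotient tends to `1` (FM83 prove the `ℤ₂`-Higgs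
analogue this way).  The ruler's CALIBRATION and S1's strong-coupling corner (S1's shape minus the pin, inside the door); no width toward PXcof
(sieve S3: inoperative as `β → ∞`).  Text = F1 + `IsCompactSimpleLieGroup G →`, identical to pool-p3's recorded repair
`AbelianNegative.ScreenedAtStrongCouplingSimple`.  Why it might fail: at the staple sizes `(2u,u)` the AREA term of the charged square
(`∝ u_r^{8u²}`-type) competes with the perimeter TUBE (`∝ u_r^{32u}`-type) until `u` is large — absorbed by `∃ L₁`; a sign slip in the leading
tube coefficient of `N_L` would break the guard `0 < N_L` (cheapest falsifier: the leading character-expansion coefficient of the charged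
eared staple for `SU(2)` fundamental). [cite: FredenhagenMarcu1983] -/
def ScreenedAtStrongCouplingSimple : Prop :=
  ∀ (G : Type) [Group G] [TopologicalSpace G] [IsTopologicalGroup G] [CompactSpace G] [MeasurableSpace G] [BorelSpace G],
    IsCompactSimpleLieGroup G →
    ∀ (r : LatticeRep G) (β : ℝ), 0 < β → 216 * (r.N : ℝ) * β ≤ 1 →
    ∀ q : ℝ, q < 1 → ∃ L₁ : ℕ, ∀ L : ℕ, L₁ ≤ L → ScreenedAt r.ρ β L q

/-- F1 ⇒ F1′ (bookkeeping: the repair only ADDS a hypothesis; contrapositively the abelian refutation of F1 says nothing about F1′). -/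
theorem screenedAtStrongCouplingSimple_of (h : ScreenedAtStrongCoupling) : ScreenedAtStrongCouplingSimple :=
  fun G _ _ _ _ _ _ _ r β hβ hN q hq => h G r β hβ hN q hq

/-- F1′ in S1's quantifier currency inside the Dobrushin door (bookkeeping): under F1′, for compact simple simply-connected `G`, every `r`,
every `0 < β ≤ 1∕(216N)` and every level `q < 1`, boxes of every fineness `L₁` read `Q_L ≥ q` — S1's body at that `β` minus the pin
`a(β)·L ≤ T` (which a strong-coupling lemma cannot supply: the pin lives at `β → ∞`). -/
theorem screened_eventually_of_simple (h : ScreenedAtStrongCouplingSimple) (G : Type) [Group G] [TopologicalSpace G]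
    [IsTopologicalGroup G] [CompactSpace G] [MeasurableSpace G] [BorelSpace G] (hG : IsCompactSimpleLieGroup G)
    (r : LatticeRep G) (β : ℝ) (h0 : 0 < β) (hβ : 216 * (r.N : ℝ) * β ≤ 1) (q : ℝ) (hq : q < 1) (L₁ : ℕ) :
    ∃ L : ℕ, max 16 L₁ ≤ L ∧ ScreenedAt r.ρ β L q := by
  obtain ⟨L₂, hL₂⟩ := h G hG r β h0 hβ q hq
  exact ⟨max (max 16 L₁) L₂, le_max_left _ _, hL₂ _ (le_max_right _ _)⟩

/-- The ruler reading is monotone in the level (bookkeeping; a lower level is easier to certify). -/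
theorem screenedAt_mono {G : Type} [Group G] [TopologicalSpace G] [IsTopologicalGroup G] [CompactSpace G]
    [MeasurableSpace G] [BorelSpace G] {N : ℕ} (ρ : G →* Matrix (Fin N) (Fin N) ℂ) {β : ℝ} {L : ℕ} {q q' : ℝ}
    (hle : q' ≤ q) (h : ScreenedAt ρ β L q) : ScreenedAt ρ β L q' := by
  obtain ⟨hN, hD, hD', hQ⟩ := h
  refine ⟨hN, hD, hD', le_trans ?_ hQ⟩
  exact mul_le_mul_of_nonneg_right hle (mul_nonneg hN.le (Real.sqrt_nonneg _))

/-! ## §6 Composition onto the slot: the route decl BY NAME -/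

/-- The bill as ONE proposition (behind a `def`, so that `IRcof_of_stubs` is the file's only crux-headed theorem). -/
def Bill : Prop :=
  PinnedScreenedCofinal → ScreenedToPure (1 / 24) → IRnscCof → Summit.QuantumFields.YangMills.Theses.BalabanLadder.IRcof

/-- **The bill holds (PROVED composition, stub-free):** `S1 → S2 → N_cof → IRcof` — the token PXcof(1∕24) by `pxcof_of_overlap`, the
simply-connected half of the leaf by the landed kernel `PinnedExitCofinal.ircofSC_of_pinnedExitsCofinal_le`, the `π₁ ≠ 1` half = N_cof, joined by
`RankPurity.IRcof_of_split`. -/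
theorem IRcof_of : Bill := by
  intro h1 h2 hN
  exact IRcof_of_split (ircofSC_of_pinnedExitsCofinal_le (by norm_num) (pxcof_of_overlap h1 h2)) hN

/-- **`IRcof` (the route's decl, literally) from the three registered stubs.** -/
theorem IRcof_of_stubs : Summit.QuantumFields.YangMills.Theses.BalabanLadder.IRcof :=
  IRcof_of stub_pinnedScreenedCofinal stub_screenedToPure stub_irnscCof

/-- The slot token from the stubs (for readers assembling by token: `PinnedCofinalBill.IRcof_of` consumes exactly this and N_cof). -/
theorem pxcof24_of_stubs : PinnedExitsCofinalAt (1 / 24) :=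
  pxcof_of_overlap stub_pinnedScreenedCofinal stub_screenedToPure

end Summit.QuantumFields.YangMills.Cruxes.IRcof.OverlapRuler

end
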